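import Literature.NumberTheory.GelbartRogawski1991.DoubledWeilRepresentationUndoublingConj
import Summits.HodgeConjecture.CorCM.D2Bridge.WeilFinRepMirror
import HarnessLib

/-!
# Crux `HLiu418`, K-lane E3 ROAD U, piece (U3): UNDOUBLING COMMUTES WITH SCALAR CONJUGATION
# `undouble (mpCongr ∘ (·)ᶜ ∘ sD ∘ θ) g = mpCongr ((undouble sD (θ₁ g))ᶜ)`

Cell `hodgecm-mathlib`, FLOOR 0, programme P5 (`F0_AlbCm`); crux item `stmt-HodgeConjecture-24832` (`HCCMUnconditional.HLiu418`);
seat A-p02 (g19), piece (U3) of F0P5-p04 (g3)'s ROAD U (`curveThetaHodgeTypeSigned_antihol ⟸ _hol` through the rank-2 conjugate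
partner `hO`), dealt by F0P5-plan (g2) DESK WORD #1 (3) (2026-08-31T03:57Z).  `--supports stmt-HodgeConjecture-24832` (helper).
THEOREMS ONLY — no definition, no instance, no notation, no named-fact hypothesis, no `sorry`.

This is the SCALAR-CONJUGATION twin of ★ `GRConstruction.undoubleHom_relabel_comp_conjH` (`DoubledWeilRepresentationUndoublingConj` §4):
there the doubled Weil representation `sD : H_{dW}(𝔸) →* Mp(𝕎^𝔻)ᶜᵒⁿᵗ` is twisted by the RELABELLING `R^𝔻` and the entrywise conjugation
`h ↦ h̄` of the doubled unitary group; here it is twisted by COMPLEX CONJUGATION OF SCALARS on the metaplectic side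
(★ `Weil1964.adelicMpContConj : Mp_ψ(W_T)ᶜᵒⁿᵗ ≃* Mp_ψ(W_{−T})ᶜᵒⁿᵗ`, `(g, M) ↦ (g, C M C)`, covering the identity of `Sp`), re-typed along
`−T^𝔻(dW) = T^𝔻(dW′)` (★ `Weil1964.mpCongr`, ★ `GRConstruction.gramDA_eq_neg`) for a second W-frame `dW′` with
`realDiagonal dW = −realDiagonal dW′` (`hneg`), and precomposed with ANY homomorphism `θ : H_{dW′}(𝔸) →* H_{dW}(𝔸)` that is the
IDENTITY ON MATRICES (`hθ`; e.g. `MulEquiv.subgroupCongr (HA_eq hneg).symm`, ★ `GRConstruction.HA_eq`).  No conjugation of the group.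

* §1 scalar bookkeeping: `C (Φ₁ ⊠ Φ₂) = C Φ₁ ⊠ C Φ₂` (`piSchwartzBruhatConj_tensorToSum`); the sign identities `−T^𝔻(dW) = T^𝔻(dW′)`,
  `−Tg(dW) = Tg(dW′)` (`neg_gramDA_eq`, `neg_gramA_eq`).
* §2 the group side for identity-on-matrices maps `θ` (doubled) and `θ₁` (pair): `θ (g ⊕ 1) = (θ₁ g) ⊕ 1` (`apply_inlG_eq_inlG`), the
  restriction-of-scalars embeddings agree (`coe_toSpD_apply_eq`, `coe_toSp_apply_eq`), and the twisted `sD♭ := mpCongr ∘ (·)ᶜ ∘ sD ∘ θ` lies over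
  `ι^𝔻_{dW′}` when `sD` lies over `ι^𝔻_{dW}` (`proj_mpCongr_conj_comp`).
* §3 **`undouble_mpCongr_conj_comp`**: for `g ∈ G₁′(𝔸)` (pair group at `dW′`),
  `undouble_{dW′} sD♭ g = mpCongr (−Tg = Tg′) ((undouble_{dW} sD (θ₁ g))ᶜ)` — by ★ `undouble_unique` at `dW′`: (a) both lie over `ι′(g)`
  (`π` does not see `mpCongr` ∕ `(·)ᶜ`: ★ `adelicMpCont.coe_proj_mpCongr`, ★ `coe_proj_adelicMpContConj`); (b) the product formula: with
  `u♭(g) = undoubleIdx′ (sD♭ (g ⊕ 1))`, `ω(u♭ g)(Φ₁ ⊠ Φ₂) = C (ω(u(θ₁ g)) (C Φ₁ ⊠ C Φ₂))` (★ `omega_undoubleIdx_apply`, `C` commutes with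
  re-indexing ★ `piSchwartzBruhatConj_piSBReindex(_symm)`, ★ `omega_mpCongr_apply`, ★ `omega_adelicMpContConj_apply`) `= C (ω(s(θ₁ g)) (C Φ₁) ⊠ C Φ₂)`
  (★ `omega_uD_tensorToSum`) `= ω(mpCongr (s(θ₁ g))ᶜ) Φ₁ ⊠ Φ₂`; and the Hom form **`undoubleHom_mpCongr_conj_comp`**.
* §4 the instance at the casts of record `θ := subgroupCongr (HA_eq hneg).symm`, `θ₁ := subgroupCongr (adelicPair_eq hneg).symm`
  (`undoubleHom_mpCongr_conj_comp_subgroupCongr`), which is (U3) as the ROAD-U pen composes it with (U1) ∕ (U2).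
HONEST LABEL: HC_CM is proved only modulo the 7 printed citations (+ declared floor-0 debt) until rung 0 closes; this file discharges
none of them.

References: [Kudla1994] S. Kudla, Israel J. Math. 87 (1994), §2 (doubled space, Siegel parabolic), §3 Thm. 3.1; [GelbartRogawski1991]
S. Gelbart, J. Rogawski, Invent. Math. 105 (1991), §3.1 p. 454–455; [Li1992] J.-S. Li, J. reine angew. Math. 428 (1992), p. 181 (`ω* = ω_{ψ̄}`);
[MoeglinVignerasWaldspurger1987] C. Mœglin, M.-F. Vignéras, J.-L. Waldspurger, LNM 1291 (1987), Chap. 2 II.1.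
-/

set_option autoImplicit false
-- the mandated namespace has the single-problem summit's repeated segment (`HodgeConjecture.HodgeConjecture`)
set_option linter.dupNamespace false

noncomputable section

open scoped Classical
open scoped Matrix Kronecker TensorProduct ComplexConjugate
open NumberField IsDedekindDomain
open Literature.RepresentationTheory.HeisenbergGroup
open Literature.NumberTheory.Automorphic
open Literature.NumberTheory.Weil1964
open Literature.NumberTheory.GaloisRepresentations
open Literature.NumberTheory.GelbartRogawski1991
open Literature.NumberTheory.GelbartRogawski1991.GRConstruction
open Literature.NumberTheory.GelbartRogawski1991.UnitaryDualPair
open Literature.NumberTheory.Automorphic.UnitaryGroup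

namespace Summit.HodgeConjecture.HodgeConjecture.Cruxes.HLiu418.UndoubleConj

/-! ## §1 Scalar bookkeeping -/

section Scalar

variable {F : Type} [Field F] [NumberField F] {ι₁ ι₂ : Type} [Fintype ι₁] [Fintype ι₂]

/-- **`C (Φ₁ ⊠ Φ₂) = C Φ₁ ⊠ C Φ₂`**: complex conjugation of Schwartz–Bruhat functions is multiplicative on pure tensors.
[cite: MoeglinVignerasWaldspurger1987, Chap. 2 II.1] -/
theorem piSchwartzBruhatConj_tensorToSum (Φ₁ : piSchwartzBruhat F ι₁) (Φ₂ : piSchwartzBruhat F ι₂) :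
    piSchwartzBruhatConj F (ι₁ ⊕ ι₂) (tensorToSum F ι₁ ι₂ Φ₁ Φ₂) =
      tensorToSum F ι₁ ι₂ (piSchwartzBruhatConj F ι₁ Φ₁) (piSchwartzBruhatConj F ι₂ Φ₂) :=
  Subtype.ext (funext fun x => by
    rw [coe_piSchwartzBruhatConj, Pi.star_apply, coe_tensorToSum, coe_tensorToSum, boxTensor_apply, boxTensor_apply,
      coe_piSchwartzBruhatConj, coe_piSchwartzBruhatConj, Pi.star_apply, Pi.star_apply, star_mul'])

end Scalar

section Sign

variable {L : Type} [Field L] [NumberField L] [IsCMField L]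
  {N M n : ℕ} {e : Fin N × Fin M ≃ Fin n}
  {dV : Fin N → L} {hdV : ∀ i, IsCMField.complexConj L (dV i) = dV i}
  {dW : Fin M → L} {hdW : ∀ i, IsCMField.complexConj L (dW i) = dW i}
  {dW' : Fin M → L} {hdW' : ∀ i, IsCMField.complexConj L (dW' i) = dW' i}

/-- `−T^𝔻(dW) ⊗ 1 = T^𝔻(dW′) ⊗ 1` (the `mpCongr` hypothesis on the doubled side; ★ `gramDA_eq_neg`). [cite: Kudla1994, §2] -/
theorem neg_gramDA_eq (hneg : realDiagonal L dW hdW = -realDiagonal L dW' hdW') :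
    -gramDA L e dV hdV dW hdW = gramDA L e dV hdV dW' hdW' :=
  neg_eq_iff_eq_neg.2 (gramDA_eq_neg (e := e) (dV := dV) (hdV := hdV) hneg)

/-- `−Tg(dW) = Tg(dW′)` (the `mpCongr` hypothesis on the undoubled side; ★ `adelicGram_neg_right`). [cite: Kudla1994, §2] -/
theorem neg_gramA_eq (hneg : realDiagonal L dW hdW = -realDiagonal L dW' hdW') :
    -gramA L e dV hdV dW hdW = gramA L e dV hdV dW' hdW' := by
  have h : gramA L e dV hdV dW hdW = -gramA L e dV hdV dW' hdW' := by
    change adelicGram (Fp L) e (realDiagonal L dV hdV) (realDiagonal L dW hdW) =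
      -adelicGram (Fp L) e (realDiagonal L dV hdV) (realDiagonal L dW' hdW')
    rw [hneg, adelicGram_neg_right]
  rw [h, neg_neg]

end Sign

/-! ## §2 The group side for identity-on-matrices maps -/

section Group

variable {L : Type} [Field L] [NumberField L] [IsCMField L]
  {N M n : ℕ} {e : Fin N × Fin M ≃ Fin n}
  {dV : Fin N → L} {hdV : ∀ i, IsCMField.complexConj L (dV i) = dV i}
  {dW : Fin M → L} {hdW : ∀ i, IsCMField.complexConj L (dW i) = dW i}
  {dW' : Fin M → L} {hdW' : ∀ i, IsCMField.complexConj L (dW' i) = dW' i}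

/-- **`θ (g ⊕ 1) = (θ₁ g) ⊕ 1`** for maps `θ : H_{dW′}(𝔸) →* H_{dW}(𝔸)`, `θ₁ : G₁′(𝔸) → G₁(𝔸)` that are the identity on matrices (`g ⊕ 1`'s
matrix does not see the W-frame; ★ `inlG`). [cite: GelbartRogawski1991, §3.1 p. 454] [cite: Kudla1994, §2] -/
theorem apply_inlG_eq_inlG (θ : HA L e dV hdV dW' hdW' →* HA L e dV hdV dW hdW)
    (hθ : ∀ h, ((θ h : HA L e dV hdV dW hdW) : GL (Fin (n + n)) (AdeleRing (𝓞 L) L)) = h)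
    (θ₁ : adelicPair (Fp L) L (IsCMField.complexConj L) N M (Matrix.diagonal dV) (Matrix.diagonal dW') →
      adelicPair (Fp L) L (IsCMField.complexConj L) N M (Matrix.diagonal dV) (Matrix.diagonal dW))
    (hθ₁ : ∀ g, ((θ₁ g : adelicPair (Fp L) L (IsCMField.complexConj L) N M (Matrix.diagonal dV) (Matrix.diagonal dW)) :
      GL (Fin N × Fin M) (AdeleRing (𝓞 L) L)) = g)
    (g : adelicPair (Fp L) L (IsCMField.complexConj L) N M (Matrix.diagonal dV) (Matrix.diagonal dW')) :
    θ (inlG L e dV hdV dW' hdW' g) = inlG L e dV hdV dW hdW (θ₁ g) := by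
  apply Subtype.ext
  rw [hθ]
  apply Units.ext
  change Matrix.reindex (e₂ (n := n)) (e₂ (n := n)) (Matrix.fromBlocks (Matrix.reindex e e
      (((g : adelicPair (Fp L) L (IsCMField.complexConj L) N M (Matrix.diagonal dV) (Matrix.diagonal dW')) :
        GL (Fin N × Fin M) (AdeleRing (𝓞 L) L)) : Matrix (Fin N × Fin M) (Fin N × Fin M) (AdeleRing (𝓞 L) L))) 0 0 1) =
    Matrix.reindex (e₂ (n := n)) (e₂ (n := n)) (Matrix.fromBlocks (Matrix.reindex e e
      (((θ₁ g : adelicPair (Fp L) L (IsCMField.complexConj L) N M (Matrix.diagonal dV) (Matrix.diagonal dW)) :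
        GL (Fin N × Fin M) (AdeleRing (𝓞 L) L)) : Matrix (Fin N × Fin M) (Fin N × Fin M) (AdeleRing (𝓞 L) L))) 0 0 1)
  rw [hθ₁]

/-- the doubled restriction-of-scalars embeddings at `dW`, `dW′` agree on elements with the same matrix: `ι^𝔻_{dW}(θ h) = ι^𝔻_{dW′}(h)` as
automorphisms of `𝕎^𝔻_𝔸` (★ `toSpD_apply_reIm`). [cite: GelbartRogawski1991, §3.1 p. 454] -/
theorem coe_toSpD_apply_eq (θ : HA L e dV hdV dW' hdW' →* HA L e dV hdV dW hdW)
    (hθ : ∀ h, ((θ h : HA L e dV hdV dW hdW) : GL (Fin (n + n)) (AdeleRing (𝓞 L) L)) = h) (h : HA L e dV hdV dW' hdW') :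
    ((toSpD L e dV hdV dW hdW (θ h) : symplecticGroup (polar (adelicForm (Fp L) (Fin (n + n)) (gramDA L e dV hdV dW hdW)))) :
        ((Fin (n + n) → AdeleRing (𝓞 (Fp L)) (Fp L)) × (Fin (n + n) → AdeleRing (𝓞 (Fp L)) (Fp L))) ≃ₗ[AdeleRing (𝓞 (Fp L)) (Fp L)]
          ((Fin (n + n) → AdeleRing (𝓞 (Fp L)) (Fp L)) × (Fin (n + n) → AdeleRing (𝓞 (Fp L)) (Fp L)))) =
      (toSpD L e dV hdV dW' hdW' h : symplecticGroup (polar (adelicForm (Fp L) (Fin (n + n)) (gramDA L e dV hdV dW' hdW')))) := by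
  refine LinearEquiv.ext fun w => ?_
  obtain ⟨x, rfl⟩ : ∃ x : Fin (n + n) → AdeleRing (𝓞 L) L,
      QuadraticCoordinates.reIm (quadraticAdeleEquiv (Fp L) L (IsCMField.complexConj L) (complexConj_imagUnit L) (imagUnit_ne_zero L)).toAddEquiv
        (Fin (n + n)) x = w :=
    ⟨(QuadraticCoordinates.reIm (quadraticAdeleEquiv (Fp L) L (IsCMField.complexConj L) (complexConj_imagUnit L) (imagUnit_ne_zero L)).toAddEquiv
        (Fin (n + n))).symm w, by rw [AddEquiv.apply_symm_apply]⟩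
  have hmat : ((θ h : HA L e dV hdV dW hdW) : GL (Fin (n + n)) (AdeleRing (𝓞 L) L)).1 = h.1.1 := congrArg Units.val (hθ h)
  rw [toSpD_apply_reIm, toSpD_apply_reIm, hmat]

/-- the undoubled restriction-of-scalars embeddings at `dW`, `dW′` agree on elements with the same matrix: `ι_{dW}(θ₁ g) = ι_{dW′}(g)` as
automorphisms of `𝕎_𝔸` (★ `HodgeCM.WeilCoinv.coe_toSp_apply`). [cite: GelbartRogawski1991, §3.1 p. 454] -/
theorem coe_toSp_apply_eq (hdV0 : ∀ i, dV i ≠ 0) (hdW0 : ∀ i, dW i ≠ 0) (hdW0' : ∀ i, dW' i ≠ 0)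
    (θ₁ : adelicPair (Fp L) L (IsCMField.complexConj L) N M (Matrix.diagonal dV) (Matrix.diagonal dW') →
      adelicPair (Fp L) L (IsCMField.complexConj L) N M (Matrix.diagonal dV) (Matrix.diagonal dW))
    (hθ₁ : ∀ g, ((θ₁ g : adelicPair (Fp L) L (IsCMField.complexConj L) N M (Matrix.diagonal dV) (Matrix.diagonal dW)) :
      GL (Fin N × Fin M) (AdeleRing (𝓞 L) L)) = g)
    (g : adelicPair (Fp L) L (IsCMField.complexConj L) N M (Matrix.diagonal dV) (Matrix.diagonal dW')) :
    (((D L e dV hdV hdV0 dW hdW hdW0).toSp (θ₁ g) : symplecticGroup (polar (adelicForm (Fp L) (Fin n) (gramA L e dV hdV dW hdW)))) :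
        ((Fin n → AdeleRing (𝓞 (Fp L)) (Fp L)) × (Fin n → AdeleRing (𝓞 (Fp L)) (Fp L))) ≃ₗ[AdeleRing (𝓞 (Fp L)) (Fp L)]
          ((Fin n → AdeleRing (𝓞 (Fp L)) (Fp L)) × (Fin n → AdeleRing (𝓞 (Fp L)) (Fp L)))) =
      ((D L e dV hdV hdV0 dW' hdW' hdW0').toSp g : symplecticGroup (polar (adelicForm (Fp L) (Fin n) (gramA L e dV hdV dW' hdW')))) := by
  refine LinearEquiv.ext fun v => ?_
  have hmat : ((θ₁ g : adelicPair (Fp L) L (IsCMField.complexConj L) N M (Matrix.diagonal dV) (Matrix.diagonal dW)) :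
      GL (Fin N × Fin M) (AdeleRing (𝓞 L) L)) = g := hθ₁ g
  show ((toSp (Fp L) L (IsCMField.complexConj L) N M e (Matrix.diagonal dV) (Matrix.diagonal dW) (complexConj_imagUnit L) (imagUnit_ne_zero L)
      (imagUnit_mul_self L) (realDiagonal_isSymm L dV hdV) (realDiagonal_isSymm L dW hdW) (realDiagonal_map L dV hdV).symm
      (realDiagonal_map L dW hdW).symm (θ₁ g) : symplecticGroup (polar (adelicForm (Fp L) (Fin n) (gramA L e dV hdV dW hdW)))) :
      ((Fin n → AdeleRing (𝓞 (Fp L)) (Fp L)) × (Fin n → AdeleRing (𝓞 (Fp L)) (Fp L))) ≃ₗ[AdeleRing (𝓞 (Fp L)) (Fp L)]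
        ((Fin n → AdeleRing (𝓞 (Fp L)) (Fp L)) × (Fin n → AdeleRing (𝓞 (Fp L)) (Fp L)))) v =
    ((toSp (Fp L) L (IsCMField.complexConj L) N M e (Matrix.diagonal dV) (Matrix.diagonal dW') (complexConj_imagUnit L) (imagUnit_ne_zero L)
      (imagUnit_mul_self L) (realDiagonal_isSymm L dV hdV) (realDiagonal_isSymm L dW' hdW') (realDiagonal_map L dV hdV).symm
      (realDiagonal_map L dW' hdW').symm g : symplecticGroup (polar (adelicForm (Fp L) (Fin n) (gramA L e dV hdV dW' hdW')))) :
      ((Fin n → AdeleRing (𝓞 (Fp L)) (Fp L)) × (Fin n → AdeleRing (𝓞 (Fp L)) (Fp L))) ≃ₗ[AdeleRing (𝓞 (Fp L)) (Fp L)]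
        ((Fin n → AdeleRing (𝓞 (Fp L)) (Fp L)) × (Fin n → AdeleRing (𝓞 (Fp L)) (Fp L)))) v
  rw [HodgeCM.WeilCoinv.coe_toSp_apply, HodgeCM.WeilCoinv.coe_toSp_apply, hmat]

/-- **`sD♭ := mpCongr ∘ (·)ᶜ ∘ sD ∘ θ` lies over `ι^𝔻_{dW′}` when `sD` lies over `ι^𝔻_{dW}`** (`π` does not see `mpCongr` ∕ `(·)ᶜ`, and
`ι^𝔻_{dW}(θ h) = ι^𝔻_{dW′}(h)`). [cite: GelbartRogawski1991, §3.1 p. 454] [cite: MoeglinVignerasWaldspurger1987, Chap. 2 II.1 (B)] -/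
theorem proj_mpCongr_conj_comp (hneg : realDiagonal L dW hdW = -realDiagonal L dW' hdW')
    (θ : HA L e dV hdV dW' hdW' →* HA L e dV hdV dW hdW)
    (hθ : ∀ h, ((θ h : HA L e dV hdV dW hdW) : GL (Fin (n + n)) (AdeleRing (𝓞 L) L)) = h)
    {sD : HA L e dV hdV dW hdW →* MpD L e dV hdV dW hdW} (hproj : ∀ h, projD L e dV hdV dW hdW (sD h) = toSpD L e dV hdV dW hdW h)
    (h : HA L e dV hdV dW' hdW') :
    projD L e dV hdV dW' hdW'
        (((mpCongr (neg_gramDA_eq (e := e) (dV := dV) (hdV := hdV) hneg)).toMonoidHom.comp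
          (((adelicMpContConj (Fp L) (Fin (n + n)) (gramDA L e dV hdV dW hdW)).toMonoidHom.comp sD).comp θ)) h) =
      toSpD L e dV hdV dW' hdW' h := by
  apply Subtype.ext
  -- `((mpCongr ∘ conj ∘ sD) ∘ θ) h` is DEFINITIONALLY `mpCongr (conj (sD (θ h)))`; no `rw`
  have e1 := adelicMpCont.coe_proj_mpCongr (neg_gramDA_eq (e := e) (dV := dV) (hdV := hdV) hneg)
    (adelicMpContConj (Fp L) (Fin (n + n)) (gramDA L e dV hdV dW hdW) (sD (θ h)))
  have e2 := coe_proj_adelicMpContConj (sD (θ h))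
  have e3 := congrArg (fun q : symplecticGroup (polar (adelicForm (Fp L) (Fin (n + n)) (gramDA L e dV hdV dW hdW))) =>
      (q : ((Fin (n + n) → AdeleRing (𝓞 (Fp L)) (Fp L)) × (Fin (n + n) → AdeleRing (𝓞 (Fp L)) (Fp L))) ≃ₗ[AdeleRing (𝓞 (Fp L)) (Fp L)]
        ((Fin (n + n) → AdeleRing (𝓞 (Fp L)) (Fp L)) × (Fin (n + n) → AdeleRing (𝓞 (Fp L)) (Fp L))))) (hproj (θ h))
  exact e1.trans (e2.trans (e3.trans (coe_toSpD_apply_eq θ hθ h)))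

end Group

/-! ## §3 Undoubling commutes with scalar conjugation -/

section Undouble

variable {L : Type} [Field L] [NumberField L] [IsCMField L]
  {N M n : ℕ} {e : Fin N × Fin M ≃ Fin n}
  {dV : Fin N → L} {hdV : ∀ i, IsCMField.complexConj L (dV i) = dV i}
  {dW : Fin M → L} {hdW : ∀ i, IsCMField.complexConj L (dW i) = dW i}
  {dW' : Fin M → L} {hdW' : ∀ i, IsCMField.complexConj L (dW' i) = dW' i}

/-- the Weil operator of `undoubleIdx′ (mpCongr (mᶜ))` is `C ∘ ω(undoubleIdx m) ∘ C` (the undoubling index change — a re-indexing followed by the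
relabelling with `C = 1` — commutes with complex conjugation of scalars: ★ `omega_undoubleIdx_apply`, ★ `piSchwartzBruhatConj_piSBReindex`,
★ `omega_mpCongr_apply`, ★ `omega_adelicMpContConj_apply`). [cite: Kudla1994, §2] [cite: Li1992, p. 181] -/
theorem omega_undoubleIdx_mpCongr_conj_apply (hneg : realDiagonal L dW hdW = -realDiagonal L dW' hdW') (m : MpD L e dV hdV dW hdW)
    (Ψ : piSchwartzBruhat (Fp L) (Fin n ⊕ Fin n)) :
    adelicMpCont.omega (Fp L) (Fin n ⊕ Fin n) (gramS L e dV hdV dW' hdW')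
        (undoubleIdx L e dV hdV dW' hdW'
          (mpCongr (neg_gramDA_eq (e := e) (dV := dV) (hdV := hdV) hneg)
            (adelicMpContConj (Fp L) (Fin (n + n)) (gramDA L e dV hdV dW hdW) m))) Ψ =
      piSchwartzBruhatConj (Fp L) (Fin n ⊕ Fin n)
        (adelicMpCont.omega (Fp L) (Fin n ⊕ Fin n) (gramS L e dV hdV dW hdW) (undoubleIdx L e dV hdV dW hdW m)
          (piSchwartzBruhatConj (Fp L) (Fin n ⊕ Fin n) Ψ)) := by
  -- no `rw` across the `adelicMpCont` telescopes (isDefEq cliff): an explicit `Eq.trans` ∕ `congrArg` chain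
  have h1 := omega_undoubleIdx_apply (e := e) (dV := dV) (hdV := hdV) dW' hdW'
    (mpCongr (neg_gramDA_eq (e := e) (dV := dV) (hdV := hdV) hneg) (adelicMpContConj (Fp L) (Fin (n + n)) (gramDA L e dV hdV dW hdW) m)) Ψ
  have h2 := adelicMpCont.omega_mpCongr_apply (neg_gramDA_eq (e := e) (dV := dV) (hdV := hdV) hneg)
    (adelicMpContConj (Fp L) (Fin (n + n)) (gramDA L e dV hdV dW hdW) m) ((piSBReindex (Fp L) (e₂ (n := n)).symm).symm Ψ)
  have h3 := adelicMpCont.omega_adelicMpContConj_apply m ((piSBReindex (Fp L) (e₂ (n := n)).symm).symm Ψ)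
  have h4 := piSchwartzBruhatConj_piSBReindex_symm (F := Fp L) (e₂ (n := n)).symm Ψ
  have h5 := omega_undoubleIdx_apply (e := e) (dV := dV) (hdV := hdV) dW hdW m (piSchwartzBruhatConj (Fp L) (Fin n ⊕ Fin n) Ψ)
  have h6 := piSchwartzBruhatConj_piSBReindex (F := Fp L) (e₂ (n := n)).symm
    (adelicMpCont.omega (Fp L) (Fin (n + n)) (gramDA L e dV hdV dW hdW) m
      ((piSBReindex (Fp L) (e₂ (n := n)).symm).symm (piSchwartzBruhatConj (Fp L) (Fin n ⊕ Fin n) Ψ)))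
  have h7 := congrArg (fun X : piSchwartzBruhat (Fp L) (Fin (n + n)) => piSBReindex (Fp L) (e₂ (n := n)).symm X) (h2.trans h3)
  have h8 := congrArg (fun Y : piSchwartzBruhat (Fp L) (Fin (n + n)) =>
      piSBReindex (Fp L) (e₂ (n := n)).symm (piSchwartzBruhatConj (Fp L) (Fin (n + n))
        (adelicMpCont.omega (Fp L) (Fin (n + n)) (gramDA L e dV hdV dW hdW) m Y))) h4
  have h9 := congrArg (fun Z : piSchwartzBruhat (Fp L) (Fin n ⊕ Fin n) => piSchwartzBruhatConj (Fp L) (Fin n ⊕ Fin n) Z) h5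
  exact h1.trans (h7.trans (h8.trans (h6.symm.trans h9.symm)))

/-- **(U3) UNDOUBLING COMMUTES WITH SCALAR CONJUGATION: `undouble_{dW′} sD♭ g = mpCongr ((undouble_{dW} sD (θ₁ g))ᶜ)`** for
`sD♭ = mpCongr ∘ (·)ᶜ ∘ sD ∘ θ` over `ι^𝔻_{dW′}` (`hproj′`, e.g. `proj_mpCongr_conj_comp`), `θ`, `θ₁` the identity on matrices: by ★ `undouble_unique`
at `dW′` — (a) `π′(mpCongr (pᶜ)) = π(p) = ι(θ₁ g) = ι′(g)` (★ `proj_undouble`, `coe_toSp_apply_eq`); (b) `ω(u♭(g))(Φ₁ ⊠ Φ₂) = C (ω(u(θ₁ g))(C Φ₁ ⊠ C Φ₂))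
= C (ω(s(θ₁ g))(C Φ₁) ⊠ C Φ₂) = ω(mpCongr (s(θ₁ g))ᶜ) Φ₁ ⊠ Φ₂` (`apply_inlG_eq_inlG`, `omega_undoubleIdx_mpCongr_conj_apply`,
`piSchwartzBruhatConj_tensorToSum`, ★ `omega_uD_tensorToSum`).  Scalar twin of ★ `undouble_relabel_comp_conjH`.
[cite: Kudla1994, §2 (doubled space, Siegel parabolic), Thm. 3.1] [cite: Li1992, p. 181] [cite: GelbartRogawski1991, §3.1 p. 454] -/
theorem undouble_mpCongr_conj_comp (hdV0 : ∀ i, dV i ≠ 0) (hdW0 : ∀ i, dW i ≠ 0) (hdW0' : ∀ i, dW' i ≠ 0)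
    (hneg : realDiagonal L dW hdW = -realDiagonal L dW' hdW')
    (θ : HA L e dV hdV dW' hdW' →* HA L e dV hdV dW hdW)
    (hθ : ∀ h, ((θ h : HA L e dV hdV dW hdW) : GL (Fin (n + n)) (AdeleRing (𝓞 L) L)) = h)
    (θ₁ : adelicPair (Fp L) L (IsCMField.complexConj L) N M (Matrix.diagonal dV) (Matrix.diagonal dW') →
      adelicPair (Fp L) L (IsCMField.complexConj L) N M (Matrix.diagonal dV) (Matrix.diagonal dW))
    (hθ₁ : ∀ g, ((θ₁ g : adelicPair (Fp L) L (IsCMField.complexConj L) N M (Matrix.diagonal dV) (Matrix.diagonal dW)) :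
      GL (Fin N × Fin M) (AdeleRing (𝓞 L) L)) = g)
    {sD : HA L e dV hdV dW hdW →* MpD L e dV hdV dW hdW} (hproj : ∀ h, projD L e dV hdV dW hdW (sD h) = toSpD L e dV hdV dW hdW h)
    (hproj' : ∀ h, projD L e dV hdV dW' hdW'
      (((mpCongr (neg_gramDA_eq (e := e) (dV := dV) (hdV := hdV) hneg)).toMonoidHom.comp
        (((adelicMpContConj (Fp L) (Fin (n + n)) (gramDA L e dV hdV dW hdW)).toMonoidHom.comp sD).comp θ)) h) =
      toSpD L e dV hdV dW' hdW' h)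
    (g : adelicPair (Fp L) L (IsCMField.complexConj L) N M (Matrix.diagonal dV) (Matrix.diagonal dW')) :
    undouble L e dV hdV hdV0 dW' hdW' hdW0' hproj' g =
      mpCongr (neg_gramA_eq (e := e) (dV := dV) (hdV := hdV) hneg)
        (adelicMpContConj (Fp L) (Fin n) (gramA L e dV hdV dW hdW) (undouble L e dV hdV hdV0 dW hdW hdW0 hproj (θ₁ g))) := by
  symm
  refine undouble_unique L e dV hdV hdV0 dW' hdW' hdW0' hproj' g _ ?_ fun Φ₁ Φ₂ => ?_
  · -- (a) `π′(mpCongr (pᶜ)) = π(p) = ι(θ₁ g) = ι′(g)`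
    apply Subtype.ext
    have e1 := adelicMpCont.coe_proj_mpCongr (neg_gramA_eq (e := e) (dV := dV) (hdV := hdV) hneg)
      (adelicMpContConj (Fp L) (Fin n) (gramA L e dV hdV dW hdW) (undouble L e dV hdV hdV0 dW hdW hdW0 hproj (θ₁ g)))
    have e2 := coe_proj_adelicMpContConj (undouble L e dV hdV hdV0 dW hdW hdW0 hproj (θ₁ g))
    have e3 := congrArg (fun q : symplecticGroup (polar (adelicForm (Fp L) (Fin n) (gramA L e dV hdV dW hdW))) =>
        (q : ((Fin n → AdeleRing (𝓞 (Fp L)) (Fp L)) × (Fin n → AdeleRing (𝓞 (Fp L)) (Fp L))) ≃ₗ[AdeleRing (𝓞 (Fp L)) (Fp L)]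
          ((Fin n → AdeleRing (𝓞 (Fp L)) (Fp L)) × (Fin n → AdeleRing (𝓞 (Fp L)) (Fp L)))))
      (proj_undouble L e dV hdV hdV0 dW hdW hdW0 hproj (θ₁ g))
    exact e1.trans (e2.trans (e3.trans (coe_toSp_apply_eq hdV0 hdW0 hdW0' θ₁ hθ₁ g)))
  · -- (b) the product formula: `u♭(g) = undoubleIdx′ (mpCongr (conj (sD (θ (g ⊕ 1)))))` DEFINITIONALLY
    have u1 := omega_undoubleIdx_mpCongr_conj_apply (e := e) (dV := dV) (hdV := hdV) hneg (sD (θ (inlG L e dV hdV dW' hdW' g)))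
      (tensorToSum (Fp L) (Fin n) (Fin n) Φ₁ Φ₂)
    have u2 := congrArg (fun h : HA L e dV hdV dW hdW =>
        piSchwartzBruhatConj (Fp L) (Fin n ⊕ Fin n)
          (adelicMpCont.omega (Fp L) (Fin n ⊕ Fin n) (gramS L e dV hdV dW hdW) (undoubleIdx L e dV hdV dW hdW (sD h))
            (piSchwartzBruhatConj (Fp L) (Fin n ⊕ Fin n) (tensorToSum (Fp L) (Fin n) (Fin n) Φ₁ Φ₂))))
      (apply_inlG_eq_inlG θ hθ θ₁ hθ₁ g)
    have u3 : adelicMpCont.omega (Fp L) (Fin n ⊕ Fin n) (gramS L e dV hdV dW' hdW')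
          (uD L e dV hdV dW' hdW'
            ((mpCongr (neg_gramDA_eq (e := e) (dV := dV) (hdV := hdV) hneg)).toMonoidHom.comp
              (((adelicMpContConj (Fp L) (Fin (n + n)) (gramDA L e dV hdV dW hdW)).toMonoidHom.comp sD).comp θ)) g)
          (tensorToSum (Fp L) (Fin n) (Fin n) Φ₁ Φ₂) =
        piSchwartzBruhatConj (Fp L) (Fin n ⊕ Fin n)
          (adelicMpCont.omega (Fp L) (Fin n ⊕ Fin n) (gramS L e dV hdV dW hdW) (uD L e dV hdV dW hdW sD (θ₁ g))
            (piSchwartzBruhatConj (Fp L) (Fin n ⊕ Fin n) (tensorToSum (Fp L) (Fin n) (Fin n) Φ₁ Φ₂))) :=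
      u1.trans u2
    -- `C (Φ₁ ⊠ Φ₂) = C Φ₁ ⊠ C Φ₂`, the product formula at `θ₁ g`, and back
    have u4 := omega_uD_tensorToSum L e dV hdV hdV0 dW hdW hdW0 hproj (θ₁ g)
      (piSchwartzBruhatConj (Fp L) (Fin n) Φ₁) (piSchwartzBruhatConj (Fp L) (Fin n) Φ₂)
    have u5 : piSchwartzBruhatConj (Fp L) (Fin n ⊕ Fin n)
          (adelicMpCont.omega (Fp L) (Fin n ⊕ Fin n) (gramS L e dV hdV dW hdW) (uD L e dV hdV dW hdW sD (θ₁ g))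
            (piSchwartzBruhatConj (Fp L) (Fin n ⊕ Fin n) (tensorToSum (Fp L) (Fin n) (Fin n) Φ₁ Φ₂))) =
        tensorToSum (Fp L) (Fin n) (Fin n)
          (piSchwartzBruhatConj (Fp L) (Fin n)
            (adelicMpCont.omega (Fp L) (Fin n) (gramA L e dV hdV dW hdW) (undouble L e dV hdV hdV0 dW hdW hdW0 hproj (θ₁ g))
              (piSchwartzBruhatConj (Fp L) (Fin n) Φ₁))) Φ₂ := by
      have v1 := congrArg (fun Y : piSchwartzBruhat (Fp L) (Fin n ⊕ Fin n) => piSchwartzBruhatConj (Fp L) (Fin n ⊕ Fin n)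
          (adelicMpCont.omega (Fp L) (Fin n ⊕ Fin n) (gramS L e dV hdV dW hdW) (uD L e dV hdV dW hdW sD (θ₁ g)) Y))
        (piSchwartzBruhatConj_tensorToSum Φ₁ Φ₂)
      have v2 := congrArg (fun Z : piSchwartzBruhat (Fp L) (Fin n ⊕ Fin n) => piSchwartzBruhatConj (Fp L) (Fin n ⊕ Fin n) Z) u4
      have v3 := piSchwartzBruhatConj_tensorToSum
        (adelicMpCont.omega (Fp L) (Fin n) (gramA L e dV hdV dW hdW) (undouble L e dV hdV hdV0 dW hdW hdW0 hproj (θ₁ g))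
          (piSchwartzBruhatConj (Fp L) (Fin n) Φ₁)) (piSchwartzBruhatConj (Fp L) (Fin n) Φ₂)
      have v4 := congrArg (fun Z : piSchwartzBruhat (Fp L) (Fin n) => tensorToSum (Fp L) (Fin n) (Fin n)
          (piSchwartzBruhatConj (Fp L) (Fin n)
            (adelicMpCont.omega (Fp L) (Fin n) (gramA L e dV hdV dW hdW) (undouble L e dV hdV hdV0 dW hdW hdW0 hproj (θ₁ g))
              (piSchwartzBruhatConj (Fp L) (Fin n) Φ₁))) Z) (piSchwartzBruhatConj_piSchwartzBruhatConj Φ₂)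
      exact v1.trans (v2.trans (v3.trans v4))
    have u6 : tensorToSum (Fp L) (Fin n) (Fin n)
          (piSchwartzBruhatConj (Fp L) (Fin n)
            (adelicMpCont.omega (Fp L) (Fin n) (gramA L e dV hdV dW hdW) (undouble L e dV hdV hdV0 dW hdW hdW0 hproj (θ₁ g))
              (piSchwartzBruhatConj (Fp L) (Fin n) Φ₁))) Φ₂ =
        tensorToSum (Fp L) (Fin n) (Fin n)
          (adelicMpCont.omega (Fp L) (Fin n) (gramA L e dV hdV dW' hdW')
            (mpCongr (neg_gramA_eq (e := e) (dV := dV) (hdV := hdV) hneg)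
              (adelicMpContConj (Fp L) (Fin n) (gramA L e dV hdV dW hdW) (undouble L e dV hdV hdV0 dW hdW hdW0 hproj (θ₁ g)))) Φ₁) Φ₂ := by
      have w1 := adelicMpCont.omega_mpCongr_apply (neg_gramA_eq (e := e) (dV := dV) (hdV := hdV) hneg)
        (adelicMpContConj (Fp L) (Fin n) (gramA L e dV hdV dW hdW) (undouble L e dV hdV hdV0 dW hdW hdW0 hproj (θ₁ g))) Φ₁
      have w2 := adelicMpCont.omega_adelicMpContConj_apply (undouble L e dV hdV hdV0 dW hdW hdW0 hproj (θ₁ g)) Φ₁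
      exact congrArg (fun X : piSchwartzBruhat (Fp L) (Fin n) => tensorToSum (Fp L) (Fin n) (Fin n) X Φ₂) (w1.trans w2).symm
    exact u3.trans (u5.trans u6)

/-- **Hom form of (U3): `undoubleHom sD♭ = mpCongr ∘ (·)ᶜ ∘ undoubleHom sD ∘ θ₁`** for a HOMOMORPHISM `θ₁` of the pair groups that is the
identity on matrices. [cite: Kudla1994, §2 (doubled space, Siegel parabolic), Thm. 3.1] [cite: Li1992, p. 181] -/
theorem undoubleHom_mpCongr_conj_comp (hdV0 : ∀ i, dV i ≠ 0) (hdW0 : ∀ i, dW i ≠ 0) (hdW0' : ∀ i, dW' i ≠ 0)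
    (hneg : realDiagonal L dW hdW = -realDiagonal L dW' hdW')
    (θ : HA L e dV hdV dW' hdW' →* HA L e dV hdV dW hdW)
    (hθ : ∀ h, ((θ h : HA L e dV hdV dW hdW) : GL (Fin (n + n)) (AdeleRing (𝓞 L) L)) = h)
    (θ₁ : adelicPair (Fp L) L (IsCMField.complexConj L) N M (Matrix.diagonal dV) (Matrix.diagonal dW') →*
      adelicPair (Fp L) L (IsCMField.complexConj L) N M (Matrix.diagonal dV) (Matrix.diagonal dW))
    (hθ₁ : ∀ g, ((θ₁ g : adelicPair (Fp L) L (IsCMField.complexConj L) N M (Matrix.diagonal dV) (Matrix.diagonal dW)) :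
      GL (Fin N × Fin M) (AdeleRing (𝓞 L) L)) = g)
    {sD : HA L e dV hdV dW hdW →* MpD L e dV hdV dW hdW} (hproj : ∀ h, projD L e dV hdV dW hdW (sD h) = toSpD L e dV hdV dW hdW h)
    (hproj' : ∀ h, projD L e dV hdV dW' hdW'
      (((mpCongr (neg_gramDA_eq (e := e) (dV := dV) (hdV := hdV) hneg)).toMonoidHom.comp
        (((adelicMpContConj (Fp L) (Fin (n + n)) (gramDA L e dV hdV dW hdW)).toMonoidHom.comp sD).comp θ)) h) =
      toSpD L e dV hdV dW' hdW' h) :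
    undoubleHom L e dV hdV hdV0 dW' hdW' hdW0'
        ((mpCongr (neg_gramDA_eq (e := e) (dV := dV) (hdV := hdV) hneg)).toMonoidHom.comp
          (((adelicMpContConj (Fp L) (Fin (n + n)) (gramDA L e dV hdV dW hdW)).toMonoidHom.comp sD).comp θ)) hproj' =
      ((mpCongr (neg_gramA_eq (e := e) (dV := dV) (hdV := hdV) hneg)).toMonoidHom.comp
          (((adelicMpContConj (Fp L) (Fin n) (gramA L e dV hdV dW hdW)).toMonoidHom.comp
            (undoubleHom L e dV hdV hdV0 dW hdW hdW0 sD hproj)))).comp θ₁ :=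
  MonoidHom.ext fun g => undouble_mpCongr_conj_comp hdV0 hdW0 hdW0' hneg θ hθ θ₁ hθ₁ hproj hproj' g

end Undouble

/-! ## §4 The instance at the casts of record `H_{dW′}(𝔸) = H_{dW}(𝔸)`, `G₁′(𝔸) = G₁(𝔸)` (★ `HA_eq`, ★ `adelicPair_eq`) -/

section Record

variable {L : Type} [Field L] [NumberField L] [IsCMField L]
  {N M n : ℕ} {e : Fin N × Fin M ≃ Fin n}
  {dV : Fin N → L} {hdV : ∀ i, IsCMField.complexConj L (dV i) = dV i}
  {dW : Fin M → L} {hdW : ∀ i, IsCMField.complexConj L (dW i) = dW i}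
  {dW' : Fin M → L} {hdW' : ∀ i, IsCMField.complexConj L (dW' i) = dW' i}

/-- `sD♭` at the cast of record lies over `ι^𝔻_{dW′}`. [cite: GelbartRogawski1991, §3.1 p. 454] -/
theorem proj_mpCongr_conj_comp_subgroupCongr (hneg : realDiagonal L dW hdW = -realDiagonal L dW' hdW')
    {sD : HA L e dV hdV dW hdW →* MpD L e dV hdV dW hdW} (hproj : ∀ h, projD L e dV hdV dW hdW (sD h) = toSpD L e dV hdV dW hdW h)
    (h : HA L e dV hdV dW' hdW') :
    projD L e dV hdV dW' hdW'
        (((mpCongr (neg_gramDA_eq (e := e) (dV := dV) (hdV := hdV) hneg)).toMonoidHom.comp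
          (((adelicMpContConj (Fp L) (Fin (n + n)) (gramDA L e dV hdV dW hdW)).toMonoidHom.comp sD).comp
            (MulEquiv.subgroupCongr (HA_eq (e := e) (dV := dV) (hdV := hdV) hneg).symm).toMonoidHom)) h) =
      toSpD L e dV hdV dW' hdW' h :=
  proj_mpCongr_conj_comp hneg _ (fun h' => MulEquiv.subgroupCongr_apply _ h') hproj h

/-- **(U3) at the casts of record**: `undoubleHom (mpCongr ∘ (·)ᶜ ∘ sD ∘ subgroupCongr) = mpCongr ∘ (·)ᶜ ∘ undoubleHom sD ∘ subgroupCongr`.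
[cite: Kudla1994, §2 (doubled space, Siegel parabolic), Thm. 3.1] [cite: Li1992, p. 181] [cite: GelbartRogawski1991, §3.1 p. 454] -/
theorem undoubleHom_mpCongr_conj_comp_subgroupCongr (hdV0 : ∀ i, dV i ≠ 0) (hdW0 : ∀ i, dW i ≠ 0) (hdW0' : ∀ i, dW' i ≠ 0)
    (hneg : realDiagonal L dW hdW = -realDiagonal L dW' hdW')
    {sD : HA L e dV hdV dW hdW →* MpD L e dV hdV dW hdW} (hproj : ∀ h, projD L e dV hdV dW hdW (sD h) = toSpD L e dV hdV dW hdW h) :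
    undoubleHom L e dV hdV hdV0 dW' hdW' hdW0'
        ((mpCongr (neg_gramDA_eq (e := e) (dV := dV) (hdV := hdV) hneg)).toMonoidHom.comp
          (((adelicMpContConj (Fp L) (Fin (n + n)) (gramDA L e dV hdV dW hdW)).toMonoidHom.comp sD).comp
            (MulEquiv.subgroupCongr (HA_eq (e := e) (dV := dV) (hdV := hdV) hneg).symm).toMonoidHom))
        (proj_mpCongr_conj_comp_subgroupCongr hneg hproj) =
      ((mpCongr (neg_gramA_eq (e := e) (dV := dV) (hdV := hdV) hneg)).toMonoidHom.comp
          (((adelicMpContConj (Fp L) (Fin n) (gramA L e dV hdV dW hdW)).toMonoidHom.comp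
            (undoubleHom L e dV hdV hdV0 dW hdW hdW0 sD hproj)))).comp
        (MulEquiv.subgroupCongr (adelicPair_eq (dV := dV) hneg).symm).toMonoidHom :=
  undoubleHom_mpCongr_conj_comp hdV0 hdW0 hdW0' hneg _ (fun h' => MulEquiv.subgroupCongr_apply _ h') _
    (fun g' => MulEquiv.subgroupCongr_apply _ g') hproj _

end Record

end Summit.HodgeConjecture.HodgeConjecture.Cruxes.HLiu418.UndoubleConj

end
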